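import Mathlib
import HarnessLib
import Summits.Ventures.LatticeQCDFlow.Exactness.MetropolisSweepExactStepErgodic
import Summits.Ventures.LatticeQCDFlow.Exactness.KickLawsNearIdentity
import Summits.Ventures.LatticeQCDFlow.Exactness.CabibboMarinariORSweep

/-!
# The engine's `'metro' + n_or × 'or'` composite on `SU(N)` lattice gauge fields converges to the Wilson measure from every start, every `N`, every `nhit ≥ 1`

HONEST FRAMING: exact (Metropolis-corrected) sampling algorithms for lattice gauge theory;
figures of merit are autocorrelation/cost numbers at stated couplings and volumes; no
continuum-physics claim.

Venture `LatticeQCDFlow` (cell pub-lqcd), topic `Exactness`, FANOUT row 9 (eng-latcore, the engine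
`latflow.core.updates.composite_sweep(f, β, 'metro', n_or)` on `SU(N)`: one N-hit Metropolis sweep with
the engine's kick law `U ← exp(X) U` (`SUNMetropolisKickLaw.sunMetropolisKick N s`, every link, `nhit`
hits) followed by `n_or` Cabibbo–Marinari over-relaxation sweeps (`CabibboMarinariORSweep.cmORSweep`,
any schedule of (link, subgroup-frame) hits) — the TYPED-EXACTNESS-MAP item "`'metro' + 'or'` on gauge
groups", open since gen-13 because the OR map is neither a translation nor continuous).  NEW WORK of the
cell over the tree (`MetropolisSweepExactStepErgodic.lean`: a compact-group Metropolis sweep with a step law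
dominating Haar near `1`, followed or preceded by ANY exact Markov kernel, converges from every start;
`SUNMetropolisKickLaw.lean`: the engine's kick law, inversion invariant, dominating
Lebesgue-through-the-chart; `SUNExpChartMinorisation.lean`: the chart dominates Haar near `1`;
`CabibboMarinariORSweep.lean`: `cmORSweep`, exact for the Wilson weight, `L ≥ 2`;
`MetropolisSweepInstances.lean`: `wilsonBoltzmann_pinched`, `gibbsProbability_eq_wilsonMeasure`;
the Literature's `connectedSpace_specialUnitaryGroup`, `wilsonAction`, `wilsonMeasure` by name).
Nothing is cited as a fact; no number is claimed.

* (the kick-law minorant `exists_smul_haar_restrict_le_sunMetropolisKick` is `KickLawsNearIdentity.lean`.)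
* `cmORSweep_invariant_gibbsProbability` — every OR schedule leaves the NORMALISED Wilson law
  `Z⁻¹ e^{−βS_W} · Haar^{⊗E}` invariant (`L ≥ 2`).
* **`wilson_sunMetropolis_orSweep_uniformlyErgodic`** — torus `(ℤ/L)^d`, `L ≥ 2`, gauge group `SU(N)`
  (`N ≥ 1`) in the defining representation, any real `β`, any kick size `s > 0`, any `nhit ≥ 1`, any
  Metropolis scan visiting every link, ANY over-relaxation schedule: the composite "Metropolis sweep, then
  the OR sweeps" satisfies `|μ₀ Kᵗ(A) − μ_{Λ,β}(A)| ≤ (1 − ε)^{⌊t/(mm+1)⌋}` for some `mm`, `ε ∈ (0, 1]`,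
  EVERY initial law `μ₀`, every `t`, every set `A`, and the Wilson measure is its unique invariant
  probability law; **`wilson_orSweep_sunMetropolis_uniformlyErgodic`** — the same for "OR sweeps, then
  the Metropolis sweep".

NOT CLAIMED: any value of `mm` or `ε` (compactness, connectedness, inverse function theorem:
astronomically bad); other representations than the defining one for the OR move; `L = 1`; the `U(1)`
and `SU(2)`-Pauli-kick instances (same argument, not written); `'hmc' + 'or'` (the HMC kernel's local
spreading in a compatible metric is gen-15/18's chart minorisation — not assembled here); floating point
and the engine's `k ≤ 10⁻¹²` skip (here `k = 0`).
-/

noncomputable section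

namespace Summit.Ventures.LatticeQCDFlow.Exactness

open MeasureTheory Measure Set Filter Topology Function ProbabilityTheory ProbabilityTheory.Kernel
open Literature.MathematicalPhysics.QuantumFieldTheory
open Literature.MathematicalPhysics.QuantumLattice (connectedSpace_specialUnitaryGroup)
open scoped ENNReal

variable (N : ℕ) (s : ℝ) [Fact (0 < s)]

variable {d L : ℕ} {m : Type*} [Fintype m] [DecidableEq m]

/-- **Every OR schedule leaves the normalised Wilson law invariant** (`L ≥ 2`): the Gibbs probability of
the weight `e^{−βS_W}` over product Haar, which is the Literature's `wilsonMeasure (suRep N) β`. -/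
theorem cmORSweep_invariant_gibbsProbability [NeZero L] (hL : 2 ≤ L) (β : ℝ)
    (sched : List (Edge d L × (Fin N ≃ Fin 2 ⊕ m))) :
    Invariant (cmORSweep (d := d) (L := L) sched)
      (gibbsProbability (Measure.pi fun _ : Edge d L => haarProbability (Matrix.specialUnitaryGroup (Fin N) ℂ))
        fun U : GaugeConfig d L (Matrix.specialUnitaryGroup (Fin N) ℂ) => Real.exp (-β * wilsonAction (suRep N) U)) := by
  refine invariant_gibbsProbability ?_
  have hdens : (fun U : GaugeConfig d L (Matrix.specialUnitaryGroup (Fin N) ℂ) =>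
      ENNReal.ofReal (Real.exp (-β * wilsonAction (suRep N) U))) =
      gibbsDensity fun U : GaugeConfig d L (Matrix.specialUnitaryGroup (Fin N) ℂ) => β * wilsonAction (suRep N) U := by
    funext U
    rw [gibbsDensity, neg_mul]
  rw [hdens]
  exact cmORSweep_invariant β hL sched

variable [NeZero N]

/-- **THE ENGINE'S `'metro' + n_or × 'or'` COMPOSITE ON `SU(N)` CONVERGES TO THE WILSON MEASURE FROM EVERY
START.**  Torus `(ℤ/L)^d` with `L ≥ 2`, gauge group `SU(N)` in the defining representation, any real `β`,
kick size `s > 0`, `nhit ≥ 1` hits per link, a Metropolis scan `Ls` through every link, and ANY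
over-relaxation schedule `sched` of (link, subgroup-frame) hits: with
`K = cmORSweep sched ∘ₖ metropolisSweep (sunMetropolisKick N s) e^{−βS_W} nhit Ls` (the sweep, then the
OR sweeps) there are `mm` and `ε ∈ (0, 1]` such that `|μ₀ Kᵗ(A) − μ_{Λ,β}(A)| ≤ (1 − ε)^{⌊t/(mm+1)⌋}` for
EVERY initial law `μ₀`, every `t`, every set `A`; and the Wilson measure is the ONLY probability law
invariant under `K`. -/
theorem wilson_sunMetropolis_orSweep_uniformlyErgodic [NeZero L] (hL : 2 ≤ L) (β : ℝ) {nhit : ℕ}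
    (hn : 1 ≤ nhit) {Ls : List (Edge d L)} (hLs : ∀ e, e ∈ Ls) (sched : List (Edge d L × (Fin N ≃ Fin 2 ⊕ m))) :
    ∃ mm : ℕ, ∃ ε : ℝ, 0 < ε ∧ ε ≤ 1 ∧
      (∀ (μ₀ : Measure (GaugeConfig d L (Matrix.specialUnitaryGroup (Fin N) ℂ))) [IsProbabilityMeasure μ₀]
          (t : ℕ) (A : Set (GaugeConfig d L (Matrix.specialUnitaryGroup (Fin N) ℂ))),
        |((fun ν : Measure (GaugeConfig d L (Matrix.specialUnitaryGroup (Fin N) ℂ)) =>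
              ν.bind (cmORSweep sched ∘ₖ metropolisSweep (sunMetropolisKick N s)
                (fun U : GaugeConfig d L (Matrix.specialUnitaryGroup (Fin N) ℂ) =>
                  Real.exp (-β * wilsonAction (suRep N) U)) nhit Ls))^[t] μ₀).real A
            - (wilsonMeasure (d := d) (L := L) (suRep N) β).real A| ≤ (1 - ε) ^ (t / (mm + 1))) ∧
      ∀ (π' : Measure (GaugeConfig d L (Matrix.specialUnitaryGroup (Fin N) ℂ))) [IsProbabilityMeasure π'],
        Invariant (cmORSweep sched ∘ₖ metropolisSweep (sunMetropolisKick N s)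
          (fun U : GaugeConfig d L (Matrix.specialUnitaryGroup (Fin N) ℂ) => Real.exp (-β * wilsonAction (suRep N) U))
          nhit Ls) π' → π' = wilsonMeasure (d := d) (L := L) (suRep N) β := by
  haveI : ConnectedSpace (Matrix.specialUnitaryGroup (Fin N) ℂ) := connectedSpace_specialUnitaryGroup
  obtain ⟨V, hV, a, ha, hν⟩ := exists_smul_haar_restrict_le_sunMetropolisKick N s
  obtain ⟨s₀, hlo, hhi, hmeas⟩ := wilsonBoltzmann_pinched (d := d) (L := L) (suRep N) continuous_suRep β
  rw [← gibbsProbability_eq_wilsonMeasure]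
  exact metropolisSweep_exactStep_uniformlyErgodic ha hV hν hmeas (Real.exp_pos _) hlo hhi hn hLs
    (cmORSweep sched) (cmORSweep_invariant_gibbsProbability N hL β sched)

/-- **THE OR SWEEPS FOLLOWED BY THE METROPOLIS SWEEP CONVERGE FROM EVERY START TOO** (the cyclic shift
`K' = metropolisSweep … ∘ₖ cmORSweep sched`): `|μ₀ K'ᵗ(A) − μ_{Λ,β}(A)| ≤ (1 − ε)^{⌊t/(mm+1)⌋}` and the
Wilson measure is the unique invariant probability law of `K'`. -/
theorem wilson_orSweep_sunMetropolis_uniformlyErgodic [NeZero L] (hL : 2 ≤ L) (β : ℝ) {nhit : ℕ}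
    (hn : 1 ≤ nhit) {Ls : List (Edge d L)} (hLs : ∀ e, e ∈ Ls) (sched : List (Edge d L × (Fin N ≃ Fin 2 ⊕ m))) :
    ∃ mm : ℕ, ∃ ε : ℝ, 0 < ε ∧ ε ≤ 1 ∧
      (∀ (μ₀ : Measure (GaugeConfig d L (Matrix.specialUnitaryGroup (Fin N) ℂ))) [IsProbabilityMeasure μ₀]
          (t : ℕ) (A : Set (GaugeConfig d L (Matrix.specialUnitaryGroup (Fin N) ℂ))),
        |((fun ν : Measure (GaugeConfig d L (Matrix.specialUnitaryGroup (Fin N) ℂ)) =>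
              ν.bind (metropolisSweep (sunMetropolisKick N s)
                (fun U : GaugeConfig d L (Matrix.specialUnitaryGroup (Fin N) ℂ) =>
                  Real.exp (-β * wilsonAction (suRep N) U)) nhit Ls ∘ₖ cmORSweep sched))^[t] μ₀).real A
            - (wilsonMeasure (d := d) (L := L) (suRep N) β).real A| ≤ (1 - ε) ^ (t / (mm + 1))) ∧
      ∀ (π' : Measure (GaugeConfig d L (Matrix.specialUnitaryGroup (Fin N) ℂ))) [IsProbabilityMeasure π'],
        Invariant (metropolisSweep (sunMetropolisKick N s)
          (fun U : GaugeConfig d L (Matrix.specialUnitaryGroup (Fin N) ℂ) => Real.exp (-β * wilsonAction (suRep N) U))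
          nhit Ls ∘ₖ cmORSweep sched) π' → π' = wilsonMeasure (d := d) (L := L) (suRep N) β := by
  haveI : ConnectedSpace (Matrix.specialUnitaryGroup (Fin N) ℂ) := connectedSpace_specialUnitaryGroup
  obtain ⟨V, hV, a, ha, hν⟩ := exists_smul_haar_restrict_le_sunMetropolisKick N s
  obtain ⟨s₀, hlo, hhi, hmeas⟩ := wilsonBoltzmann_pinched (d := d) (L := L) (suRep N) continuous_suRep β
  rw [← gibbsProbability_eq_wilsonMeasure]
  exact metropolisSweep_exactStep_uniformlyErgodic' ha hV hν hmeas (Real.exp_pos _) hlo hhi hn hLs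
    (cmORSweep sched) (cmORSweep_invariant_gibbsProbability N hL β sched)

end Summit.Ventures.LatticeQCDFlow.Exactness
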